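import Summits.ResolutionOfSingularities.ResolutionOfSingularities.Theorems.ValuativeLuAlphaPTorsorMainInductionDim
import Summits.ResolutionOfSingularities.ResolutionOfSingularities.Theorems.ValuativeLuAlphaPTorsorPhaseOneDim
import Summits.ResolutionOfSingularities.ResolutionOfSingularities.Theorems.ValuativeLuAlphaPTorsorSequenceSchema
import Summits.ResolutionOfSingularities.ResolutionOfSingularities.Theorems.ValuativeLuAlphaPTorsorLogPrincipalizationLowDim
import Summits.ResolutionOfSingularities.ResolutionOfSingularities.Theorems.ValuativeLuAlphaPTorsorNePow
import Summits.ResolutionOfSingularities.ResolutionOfSingularities.Theorems.ValuativeLuAlphaPTorsorTowerMember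

/-!
# Mon_ν(2): log-principalization of `d(t^p)` along `ν` in base dimension `≤ 2` (assembly)

Crux `Valuative.LuAlphaPTorsor` (item `stmt-ResolutionOfSingularities-0641`), line
`pfaff-line-log-final-forms`, registered stub `logPrincipalization_of_ringKrullDim_le_two`
(milestone Mon_ν(2) of the promoted gen-1 stub `stub_logPrincipalization`): for a finitely
generated `A₀ ⊆ O`, regular of dimension `≤ 2` at the centre of the valuation ring `O`, and
`t ^ p ∈ A₀` not a `p`-th power in the local ring of the base at the centre, some finitely
generated model `A₀ ≤ A₁ ⊆ O` of the base, regular at the centre, carries a regular system of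
parameters `u`, a boundary `E` and exponents `M` for which the `E`-logarithmic content ideal of
`t ^ p` — `({δ (t^p) | δ ∈ Der_ℤ((A₁)_centre), δ (u_i) ∈ (u_i) ∀ i ∈ E})` — is EXACTLY the
monomial ideal `(∏_{i ∈ E} u_i ^ M_i)`. This is J. Giraud's Théorème 2.4 (*Forme normale d'une
fonction sur une surface de caractéristique positive*, Bull. SMF 111 (1983)) run ALONG THE
VALUATION and over an ARBITRARY ground field; all the mathematics is in the landed files of the
line, this file is the assembly:

* dimension `≤ 1`: `logPrincipalization_of_ringKrullDim_le_one` (no blow-up);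
* dimension `2`: realise `K₀ = Frac A₀ = Subfield.closure A₀` with its embedding `ι` into `K`;
  the local ring `R 0` of the pulled-back base at the centre of `O.comap ι` is a two-dimensional
  regular local ring of `K₀`, dominated, Japanese in dimension one (`base_locAtCentre_comap`);
  its quadratic sequence `R` along `O.comap ι` exists
  (`isQuadraticTransformAlong_quadraticSeq_of_ringKrullDim_eq_two`) and satisfies the schema
  (regular, rich in `ℤ`-derivations, dual derivations at two-dimensional stages, presented:
  `sequence_schema`); the radicand `f = t ^ p ∈ R 0` is not a `p`-th power (transport along
  `exists_ringEquiv_atPrime`), hence has non-zero content (`exists_derivation_apply_ne_zero`);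
  Giraud's phase one (`giraud_phase_one_of_dim`) and main induction
  (`giraud_main_induction_of_dim`) produce a stage `j` which is of dimension `≤ 1` or carries a
  monomial logarithmic content of `f_j`; the stage is the local ring of a finitely generated
  model `A₁` (`exists_model_of_sequence_member`), along which regularity, the regular system of
  parameters, the dimension, non-`p`-th-powers (`forall_ne_pow_of_isQuadraticTransformAlong`)
  and the content (`content_eq_span_prod_pow_of_ringEquiv`) are transported; a stage of
  dimension `≤ 1` is finished by the dimension-`≤ 1` theorem applied to `A₁`.
-/

set_option linter.dupNamespace false

noncomputable section

open IsLocalRing Literature.AlgebraicGeometry.Resolution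

namespace Summit.ResolutionOfSingularities.ResolutionOfSingularities.Theorems.PfaffLine

/-- **Non-`p`-th powers persist along a sequence of quadratic transforms.** If `a ∈ R 0` is not
a `p`-th power in the regular local ring `R 0`, then its image in every member `R j` of a
sequence of quadratic transforms along `O` starting at `R 0` is not a `p`-th power in `R j`
(iterate `forall_ne_pow_of_isQuadraticTransformAlong`; the members are regular). [folklore] -/
theorem forall_ne_pow_sequence {K : Type} [Field K] (O : ValuationSubring K) (R : ℕ → Subring K)
    (hreg : IsRegularLocalRing (R 0))
    (hstep : ∀ i, IsQuadraticTransformAlong O (R i) (R (i + 1))) (p : ℕ) (a : R 0)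
    (ha : ∀ c : R 0, a ≠ c ^ p) (j : ℕ) :
    ∀ c : R j, Subring.inclusion (sequence_monotone hstep (Nat.zero_le j)) a ≠ c ^ p := by
  induction j with
  | zero =>
    intro c hc
    have h0 : Subring.inclusion (sequence_monotone hstep (Nat.zero_le 0)) a = a := Subtype.ext rfl
    exact ha c (h0 ▸ hc)
  | succ j ih =>
    haveI : IsRegularLocalRing (R j) := isRegularLocalRing_sequence hreg hstep j
    have hfi : Subring.inclusion (sequence_monotone hstep (Nat.zero_le (j + 1))) a =
        Subring.inclusion (hstep j).le
          (Subring.inclusion (sequence_monotone hstep (Nat.zero_le j)) a) := Subtype.ext rfl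
    rw [hfi]
    exact forall_ne_pow_of_isQuadraticTransformAlong O (R j) (R (j + 1)) (hstep j) p _ ih

/-- **Registered stub `logPrincipalization_of_ringKrullDim_le_two` (Mon_ν(2)): Giraud's
Théorème 2.4 along a valuation, arbitrary ground field.** For `A₀ ⊆ O` a finitely generated
`k`-subalgebra of `K` (`char k = p`), regular of dimension `≤ 2` at the centre of the valuation
ring `O`, and `t ^ p ∈ A₀` not a `p`-th power in the local ring of the base at the centre: some
finitely generated `A₀ ≤ A₁ ⊆ O`, regular at the centre, carries a regular system of parameters
`u`, a boundary `E ⊆ {indices}` and exponents `M` such that the `E`-logarithmic content ideal of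
`t ^ p` in `(A₁)_centre` is the monomial ideal `(∏_{i ∈ E} u_i ^ M_i)`. Dimension `≤ 1`:
`logPrincipalization_of_ringKrullDim_le_one`. Dimension `2`: Giraud's induction along the
quadratic sequence of the pulled-back base inside `K₀ = Frac A₀` (`giraud_phase_one_of_dim`,
`giraud_main_induction_of_dim`, schema `sequence_schema`), then transport to a finitely generated
model of the final stage (`exists_model_of_sequence_member`,
`content_eq_span_prod_pow_of_ringEquiv`). The hypothesis `IsFractionRing (A₀[t]) K` is not used.
[cite: Giraud1983, Thm. 2.4] -/
theorem logPrincipalization_of_ringKrullDim_le_two : ∀ p : ℕ, p.Prime → ∀ (k K : Type) [Field k] [CharP k p] [Field K] [Algebra k K] (O : ValuationSubring K) (A₀ : Subalgebra k K) (h₀ : A₀.toSubring ≤ O.toSubring) (t : K), A₀.FG → ∀ (htp : t ^ p ∈ A₀), IsFractionRing (Algebra.adjoin k (insert t (A₀ : Set K))) K → IsRegularLocalRing (Localization.AtPrime (Ideal.comap (Subring.inclusion h₀) (IsLocalRing.maximalIdeal O))) → ringKrullDim (Localization.AtPrime (Ideal.comap (Subring.inclusion h₀) (IsLocalRing.maximalIdeal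 O))) ≤ 2 → (∀ c : Localization.AtPrime (Ideal.comap (Subring.inclusion h₀) (IsLocalRing.maximalIdeal O)), algebraMap A₀.toSubring (Localization.AtPrime (Ideal.comap (Subring.inclusion h₀) (IsLocalRing.maximalIdeal O))) ⟨t ^ p, htp⟩ ≠ c ^ p) → ∃ (A₁ : Subalgebra k K) (h₁ : A₁.toSubring ≤ O.toSubring) (hle : A₀ ≤ A₁), A₁.FG ∧ IsRegularLocalRing (Localization.AtPrime (Ideal.comap (Subring.inclusion h₁) (IsLocalRing.maximalIdeal O))) ∧ ∃ (d : ℕ) (u : Fin d → Localization.AtPrime (Ideal.comap (Subring.inclusion h₁) (IsLocalRing.maximalIdeal O))) (E : Finset (Fin d)) (M : Fin d → ℕ), Ideal.span (Set.range u) = IsLocalRing.maximalIdeal (Localization.AtPrime (Ideal.comap (Subring.inclusion h₁) (IsLocalRing.maximalIdeal O))) ∧ ringKrullDim (Localization.AtPrime (Ideal.comap (Subring.inclusion h₁) (IsLocalRing.maximalIdeal O))) = (d : WithBot ℕ∞) ∧ Ideal.span {b | ∃ δ : Derivation ℤ (Localization.AtPrime (Ideal.comap (Subring.inclusion h₁)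 (IsLocalRing.maximalIdeal O))) (Localization.AtPrime (Ideal.comap (Subring.inclusion h₁) (IsLocalRing.maximalIdeal O))), (∀ i ∈ E, δ (u i) ∈ Ideal.span {u i}) ∧ δ (algebraMap A₁.toSubring (Localization.AtPrime (Ideal.comap (Subring.inclusion h₁) (IsLocalRing.maximalIdeal O))) ⟨t ^ p, hle htp⟩) = b} = Ideal.span {E.prod fun i => u i ^ M i} := by
  intro p hp k K _ _ _ _ O A₀ h₀ t hfg htp _hfr hreg hdim hpow
  classical
  haveI : Fact p.Prime := ⟨hp⟩
  haveI := hreg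
  -- (0) the dimension of the base at the centre is `≤ 1` (done, no blow-up) or `= 2`
  by_cases hdim1 : ringKrullDim (Localization.AtPrime (Ideal.comap (Subring.inclusion h₀)
      (maximalIdeal O))) ≤ 1
  · exact logPrincipalization_of_ringKrullDim_le_one p hp k K O A₀ h₀ t hfg htp hreg hdim1 hpow
  have hdim2 : ringKrullDim (Localization.AtPrime (Ideal.comap (Subring.inclusion h₀)
      (maximalIdeal O))) = 2 := by
    obtain ⟨n, hn⟩ : ∃ n : ℕ, ringKrullDim (Localization.AtPrime (Ideal.comap (Subring.inclusion h₀)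
        (maximalIdeal O))) = n :=
      ⟨_, (IsRegularLocalRing.spanFinrank_maximalIdeal (R := _)).symm⟩
    rw [hn] at hdim hdim1 ⊢
    have h2 : n ≤ 2 := by exact_mod_cast hdim
    have h1 : ¬ n ≤ 1 := fun h => hdim1 (by exact_mod_cast h)
    obtain rfl : n = 2 := by omega
    rfl
  -- (1) the subfield `K₀ = Frac A₀` of `K`, the pulled-back valuation ring and base
  set K₀ : Subfield K := Subfield.closure (A₀ : Set K)
  set ι : K₀ →+* K := K₀.subtype
  have hιrange : ∀ x : K, x ∈ ι.range ↔ x ∈ K₀ := fun x =>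
    ⟨fun ⟨y, hy⟩ => hy ▸ y.2, fun hx => ⟨⟨x, hx⟩, rfl⟩⟩
  have hA₀range : A₀.toSubring ≤ ι.range := fun x hx =>
    (hιrange x).mpr (Subfield.subset_closure hx)
  have hclos : Subring.closure (A₀ : Set K) = A₀.toSubring := by
    rw [← Subalgebra.coe_toSubring, Subring.closure_eq]
  have hfrac : ∀ z : K₀, ∃ a ∈ A₀.toSubring, ∃ c ∈ A₀.toSubring, ι z = a / c := by
    intro z
    obtain ⟨y, hy, w, hw, hz⟩ := Subfield.mem_closure_iff.mp z.2
    rw [hclos] at hy hw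
    exact ⟨y, hy, w, hw, hz.symm⟩
  set O' : ValuationSubring K₀ := O.comap ι
  set A₀' : Subring K₀ := A₀.toSubring.comap ι
  have h₀' : A₀' ≤ O'.toSubring := comap_le_comap_valuationSubring ι h₀
  -- (2) the local ring `R₀` of the pulled-back base at the centre
  set R₀ : Subring K₀ := locAtCentre A₀' O'
  obtain ⟨hreg₀, hdim₀, hof₀, hdom₀, hjap⟩ :=
    base_locAtCentre_comap ι O A₀ h₀ hfg hreg hdim2 hA₀range hfrac
  -- (3) its quadratic sequence along `O'`
  have hstep := isQuadraticTransformAlong_quadraticSeq_of_ringKrullDim_eq_two hreg₀ hdim₀ hdom₀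
  set R : ℕ → Subring K₀ := quadraticSeq O' R₀
  have hR0 : R 0 = R₀ := rfl
  have hregj : ∀ j, IsRegularLocalRing (R j) := isRegularLocalRing_sequence hreg₀ hstep
  -- (4) the schema along the sequence: richness, dual derivations (dimension-2 stages),
  -- presentations
  have hsch := fun n => sequence_schema p k K O A₀ h₀ hfg hreg hdim2 R hR0 hstep n
  have hrich : ∀ (i : ℕ) (N : Type) [CommRing N] (ψ : R i →+* N) (δ₀ : R i →+ N),
      (∀ a b, δ₀ (a * b) = ψ a * δ₀ b + ψ b * δ₀ a) → ∀ Y : Finset (R i),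
        ∃ (m : ℕ) (Δ : Fin m → Derivation ℤ (R i) (R i)) (nn : Fin m → N),
          ∀ y ∈ Y, δ₀ y = Finset.univ.sum fun j => ψ (Δ j y) * nn j :=
    fun i => (hsch i).2.1
  have hdual : ∀ (i : ℕ) (v : Fin 2 → R i), ringKrullDim (R i) = 2 →
      (∀ z : R i, z ∈ Ideal.span (Set.range v) ↔ ¬ IsUnit z) →
        ∃ D : Fin 2 → Derivation ℤ (R i) (R i), ∀ l j, D l (v j) = if l = j then 1 else 0 :=
    fun i => (hsch i).2.2.1
  -- (5) the radicand `f = t ^ p` in `R 0`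
  have htpK₀ : t ^ p ∈ K₀ := Subfield.subset_closure htp
  have htpA₀' : (⟨t ^ p, htpK₀⟩ : K₀) ∈ A₀' := htp
  set f : R 0 := ⟨⟨t ^ p, htpK₀⟩, le_locAtCentre A₀' O' htpA₀'⟩ with hf_def
  -- (6) `f` is not a `p`-th power in `R 0` (transport of `hpow` along `R 0 ≃ (A₀)_centre`)
  have hR0' : (locAtCentre A₀.toSubring O).comap ι = R 0 := comap_locAtCentre ι O hA₀range
  obtain ⟨e₀, he₀⟩ := exists_ringEquiv_atPrime ι O A₀.toSubring h₀ hA₀range hR0'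
  have hf₀ : e₀ f = algebraMap A₀.toSubring (Localization.AtPrime (Ideal.comap
      (Subring.inclusion h₀) (maximalIdeal O))) ⟨t ^ p, htp⟩ := he₀ f htp
  have hfne : ∀ c : R 0, f ≠ c ^ p := by
    intro c hc
    apply hpow (e₀ c)
    rw [← hf₀, hc, map_pow]
  -- (7) the content ideal of `f` is non-zero (non-`p`-th powers are seen by `ℤ`-derivations)
  obtain ⟨m₀, 𝔮₀, h𝔮₀, Φq₀, hΦq₀⟩ := (hsch 0).2.2.2
  haveI := h𝔮₀
  haveI : IsRegularLocalRing (R 0) := hregj 0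
  obtain ⟨δ, hδ⟩ := exists_derivation_apply_ne_zero hp 𝔮₀ Φq₀ hΦq₀ hfne
  have hJne : Ideal.span {b | ∃ δ : Derivation ℤ (R 0) (R 0), δ f = b} ≠ ⊥ := by
    intro hbot
    have hmem : δ f ∈ Ideal.span {b | ∃ δ : Derivation ℤ (R 0) (R 0), δ f = b} :=
      Ideal.subset_span ⟨δ, rfl⟩
    rw [hbot, Ideal.mem_bot] at hmem
    exact hδ hmem
  -- (8) Giraud: phase one, then the main induction; Krull for the dimension of the final stage
  obtain ⟨j, hj⟩ : ∃ j : ℕ, ringKrullDim (R j) ≤ 1 ∨ (ringKrullDim (R j) = 2 ∧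
      ∃ (u : Fin 2 → R j) (E : Finset (Fin 2)) (N : Fin 2 → ℕ),
        Ideal.span (Set.range u) = maximalIdeal (R j) ∧
        Ideal.span {b | ∃ δ : Derivation ℤ (R j) (R j),
            (∀ l ∈ E, δ (u l) ∈ Ideal.span {u l}) ∧
              δ (Subring.inclusion (sequence_monotone hstep (Nat.zero_le j)) f) = b} =
          Ideal.span {E.prod fun l => u l ^ N l}) := by
    obtain ⟨i, hi⟩ :=
      giraud_phase_one_of_dim O' R hreg₀ hdim₀ hof₀ hdom₀ hstep hjap hrich hdual f hJne
    rcases hi with h1 | ⟨u, N, J₀, hu, hJ, hfin⟩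
    · exact ⟨i, Or.inl h1⟩
    obtain ⟨j, -, hj⟩ := giraud_main_induction_of_dim O' R hreg₀ hdim₀ hdom₀ hstep hrich hdual f i
      (Or.inl ⟨u, N, J₀, hu, hJ, hfin⟩)
    rcases hj with h1 | ⟨u, E, N, hu, hc⟩
    · exact ⟨j, Or.inl h1⟩
    haveI := hregj j
    have hspan : Ideal.span (Set.range u) = maximalIdeal (R j) :=
      forall_mem_iff_not_isUnit_iff_mainInductionDim.mp hu
    rcases ringKrullDim_le_one_or_eq_two_mainInductionDim u hspan with h1 | h2
    · exact ⟨j, Or.inl h1⟩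
    · exact ⟨j, Or.inr ⟨h2, u, E, N, hspan, hc⟩⟩
  -- (9) a finitely generated model `A₁` of the stage `j`, `R j ≃ (A₁)_centre`
  haveI := hregj j
  obtain ⟨A₁, h₁, hle, hfg₁, -, -, e, he⟩ :=
    exists_model_of_sequence_member k K K₀ ι O A₀ h₀ hfg hA₀range R hR0 hstep j
  have hreg₁ : IsRegularLocalRing
      (Localization.AtPrime (Ideal.comap (Subring.inclusion h₁) (maximalIdeal O))) :=
    IsRegularLocalRing.of_ringEquiv e
  set fj : R j := Subring.inclusion (sequence_monotone hstep (Nat.zero_le j)) f with hfj_def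
  have hfj : e fj = algebraMap A₁.toSubring (Localization.AtPrime (Ideal.comap
      (Subring.inclusion h₁) (maximalIdeal O))) ⟨t ^ p, hle htp⟩ := he fj (hle htp)
  rcases hj with h1 | ⟨h2, u, E, N, hspan, hc⟩
  · -- (10a) a stage of dimension `≤ 1`: the dimension-`≤ 1` theorem on the model `A₁`
    have hdim₁ : ringKrullDim
        (Localization.AtPrime (Ideal.comap (Subring.inclusion h₁) (maximalIdeal O))) ≤ 1 := by
      rw [← ringKrullDim_eq_of_ringEquiv e]; exact h1
    have hfjne := forall_ne_pow_sequence O' R hreg₀ hstep p f hfne j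
    have hpow₁ : ∀ c : Localization.AtPrime (Ideal.comap (Subring.inclusion h₁) (maximalIdeal O)),
        algebraMap A₁.toSubring (Localization.AtPrime (Ideal.comap (Subring.inclusion h₁)
          (maximalIdeal O))) ⟨t ^ p, hle htp⟩ ≠ c ^ p := by
      intro c hc
      refine hfjne (e.symm c) (e.injective ?_)
      rw [map_pow, e.apply_symm_apply, hfj, hc]
    obtain ⟨A₂, h₂, hle₂, hfg₂, hreg₂, rest⟩ :=
      logPrincipalization_of_ringKrullDim_le_one p hp k K O A₁ h₁ t hfg₁ (hle htp) hreg₁ hdim₁ hpow₁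
    exact ⟨A₂, h₂, hle.trans hle₂, hfg₂, hreg₂, rest⟩
  · -- (10b) monomial logarithmic content at the two-dimensional stage `j`: transport to `A₁`
    refine ⟨A₁, h₁, hle, hfg₁, hreg₁, 2, ⇑e ∘ u, E, N, ?_, ?_, ?_⟩
    · rw [Set.range_comp, ← Ideal.map_span, hspan, map_ringEquiv_maximalIdeal]
    · rw [← ringKrullDim_eq_of_ringEquiv e, h2]; rfl
    · have key := content_eq_span_prod_pow_of_ringEquiv e u E N fj hc
      rw [hfj] at key
      exact key

end Summit.ResolutionOfSingularities.ResolutionOfSingularities.Theorems.PfaffLine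

end
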